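import Summits.Schanuel.Schanuel.Theses.RoyCriterion
import Literature.NumberTheory.Transcendental.KirbyWeakSchanuelAx
import Literature.NumberTheory.Transcendental.EclPregeometryProofs
import Literature.NumberTheory.Transcendental.SchanuelEclEmptyProofs
import Literature.NumberTheory.Transcendental.LindemannWeierstrassProofs

-- `Summit.Schanuel.Schanuel.…` is the mandated layout of this single-problem summit (CONVENTIONS §1).
set_option linter.dupNamespace false

/-!
# Route `RoyCriterion`, crux `SchanuelTwo` (stmt-Schanuel-0069), line `CardA_BW` — stub
# `stub_eclReduction`: Kirby's reduction to `ecl(∅)²` at rank 2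

The crux `Summit.Schanuel.Schanuel.Theses.RoyCriterion.SchanuelTwo` is Schanuel's conjecture for
`n = 2`: for `x : Fin 2 → ℂ` linearly independent over `ℚ`, `2 ≤ trdeg_ℚ ℚ(x, e^x)`. Line `CardA_BW`
(idea `bw-log-rich-planes`) proves it as `stub_eclReduction (pointwise sector analysis on ecl(∅)²)`;
this file is the OUTER TRANSFER `stub_eclReduction`: the crux follows from its restriction to pairs of
EXPONENTIALLY ALGEBRAIC numbers (`x i ∈ ecl ∅`, Kirby's exponential-algebraic closure of `∅` in `ℂ_exp`).

This is Kirby 2010, Prop. 7.2 ("the essential counterexamples to Schanuel's conjecture lie in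
`ecl(∅)`") sliced at rank 2. Kirby's argument lowers the rank and never raises it, so it runs below
any rank bound `N` (`schanuelRank_of_ecl_le`): split `V = span_ℚ(x)` as `W ⊕ U` with `W = V ∩ ecl ∅`;
a basis `y` of `W` (cleared of denominators) is an `ecl ∅`-tuple of rank `k ≤ N`, so `k ≤ trdeg ℚ(y, e^y)`
by hypothesis; a basis `z` of `U` is `ℚ`-free modulo `ecl ∅`, so `m ≤ trdeg` of `(z, e^z)` over
`ℚ(ecl ∅)` by Kirby's relative Schanuel theorem over `ecl ∅` (Thm. 1.2 = Ax's theorem; tree, PROVED: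
`Literature.NumberTheory.Transcendental.kirby_relative_schanuel_complex_holds`), hence over the smaller
base `ℚ(y, e^y) ≤ ℚ(ecl ∅)` (`ecl ∅` is an exp-closed subfield, Lemma 3.3; tree, PROVED:
`Literature.NumberTheory.Transcendental.Kirby2010_ecl_isExpSubfield_holds`); the tower adds up to
`n = k + m ≤ trdeg ℚ(y, z, e^y, e^z) ≤ trdeg ℚ(x, e^x)`. At `N = 2` the restricted hypothesis in ranks
`0` and `1` is trivial / the Hermite–Lindemann floor (`eclReduction_one_le_trdeg_of_linearIndependent`,
tree theorem `transcendental_exp_holds`), and rank `2` is the hypothesis of the stub.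

Ported (def-free, proofs verbatim) from the crux disprover's kernel-checked workfile
`Summits/Schanuel/Schanuel/Cruxes/SchanuelTwo/Disproof.lean` §8 (seat refuter-cdisprove-stmt-Schanuel-0069-0:
`one_le_trdeg_of_linearIndependent'`, `schanuelRank_of_ecl_le`, `schanuelTwo_iff_ecl`), which is not
importable from `Theorems/`; the bookkeeping lemmas `trdeg_adjoin_le_of_le`, `add_le_trdeg_adjoin_union`,
`exists_nsmul_mem_span_int`, `mem_adjoin_of_mem_span_int` are the tree's (`SchanuelEclEmptyProofs`).
No definitions, no sorry; axioms `propext`, `Classical.choice`, `Quot.sound`.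

## References

* J. Kirby, *Exponential algebraicity in exponential fields*, Bull. Lond. Math. Soc. 42 (2010)
  879–890, arXiv:0810.4285: Thm. 1.2, Lemma 3.3, Prop. 7.2.
* A. Baker, *Transcendental Number Theory* (1975), Ch. 1, Theorem 1.4 (Hermite–Lindemann).
-/

noncomputable section

open Complex IntermediateField

namespace Summit.Schanuel.Schanuel.Theorems

/-- **Hermite–Lindemann floor in any rank**: a `ℚ`-linearly independent family `x : Fin n → ℂ` with an
index `i` has `1 ≤ trdeg_ℚ ℚ(x, e^x)` — `x i ≠ 0`, so either `x i` is transcendental or `e^{x i}` is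
(tree theorem `Literature.NumberTheory.Transcendental.transcendental_exp_holds`).
[cite: BakerTNT1975, Ch. 1 Theorem 1.4] -/
theorem eclReduction_one_le_trdeg_of_linearIndependent {n : ℕ} (x : Fin n → ℂ) (i : Fin n)
    (hx : LinearIndependent ℚ x) :
    (1 : Cardinal) ≤ Algebra.trdeg ℚ (adjoin ℚ (Set.range x ∪ Set.range (Complex.exp ∘ x))) := by
  have hx0 : x i ≠ 0 := hx.ne_zero i
  obtain ⟨t, htK, ht⟩ : ∃ t : ℂ, t ∈ adjoin ℚ (Set.range x ∪ Set.range (Complex.exp ∘ x)) ∧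
      Transcendental ℚ t := by
    by_cases halg : IsAlgebraic ℚ (x i)
    · exact ⟨cexp (x i), subset_adjoin _ _ (Or.inr ⟨i, rfl⟩),
        Literature.NumberTheory.Transcendental.transcendental_exp_holds halg hx0⟩
    · exact ⟨x i, subset_adjoin _ _ (Or.inl ⟨i, rfl⟩), halg⟩
  haveI : Algebra.Transcendental ℚ (adjoin ℚ (Set.range x ∪ Set.range (Complex.exp ∘ x))) :=
    ⟨⟨⟨t, htK⟩, fun h => ht (IntermediateField.isAlgebraic_iff.mp h)⟩⟩
  exact Cardinal.one_le_iff_pos.mpr (trdeg_pos ℚ _)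

open Submodule Literature.NumberTheory.Transcendental in
/-- **Kirby's reduction, bounded rank** (Kirby 2010, Prop. 7.2, run below a rank bound `N`; inputs:
Kirby's Thm. 1.2 over `ecl ∅`, PROVED in tree as `kirby_relative_schanuel_complex_holds`, and
Lemma 3.3, `Kirby2010_ecl_isExpSubfield_holds`): if Schanuel's conjecture holds for `ecl(∅)`-tuples of
every rank `≤ N` then it holds for all tuples of every rank `n ≤ N` (`SchanuelRank n`). Proof: split
`span_ℚ(x) = W ⊕ U`, `W = span_ℚ(x) ∩ ecl ∅`; bases `y` of `W` (in `ecl ∅`) and `z` of `U` (free modulo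
`ecl ∅`), cleared of denominators so that `y, z, e^y, e^z ∈ ℚ(x, e^x)`; then
`n = dim W + dim U ≤ trdeg ℚ(y, e^y) + trdeg_{ℚ(y, e^y)} ℚ(y, e^y)(z, e^z) ≤ trdeg ℚ(x, e^x)`.
[cite: Kirby2010EAEF, Prop. 7.2] -/
theorem schanuelRank_of_ecl_le (N : ℕ)
    (H : ∀ k, k ≤ N → ∀ y : Fin k → ℂ, (∀ i, y i ∈ ecl (∅ : Set ℂ)) → LinearIndependent ℚ y →
      (k : Cardinal) ≤ Algebra.trdeg ℚ (adjoin ℚ (Set.range y ∪ Set.range (Complex.exp ∘ y))))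
    (n : ℕ) (hnN : n ≤ N) : Literature.NumberTheory.Transcendental.SchanuelRank n := by
  have hrel := kirby_relative_schanuel_complex_holds
  have hE := Kirby2010_ecl_isExpSubfield_holds ℂ
  intro x hx
  obtain ⟨⟨SE, hSE⟩, hexp⟩ := hE ∅
  let Eq : Submodule ℚ ℂ :=
    { carrier := ecl (∅ : Set ℂ)
      add_mem' := fun {a b} ha hb => by
        rw [← hSE] at ha hb ⊢; exact SE.add_mem ha hb
      zero_mem' := by rw [← hSE]; exact SE.zero_mem
      smul_mem' := fun q {a} ha => by
        rw [← hSE] at ha ⊢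
        rw [Rat.smul_def]
        exact SE.mul_mem (SubfieldClass.ratCast_mem SE q) ha }
  have hEq : (Eq : Set ℂ) = ecl (∅ : Set ℂ) := rfl
  have hspanE : span ℚ (ecl (∅ : Set ℂ)) = Eq := by rw [← hEq, span_eq]
  set V : Submodule ℚ ℂ := span ℚ (Set.range x) with hV
  haveI : FiniteDimensional ℚ V := FiniteDimensional.span_of_finite ℚ (Set.finite_range x)
  set W : Submodule ℚ ℂ := V ⊓ Eq with hW
  obtain ⟨U', hU'⟩ := W.exists_isCompl
  set U : Submodule ℚ ℂ := V ⊓ U' with hU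
  haveI : FiniteDimensional ℚ W := Submodule.finiteDimensional_of_le inf_le_left
  haveI : FiniteDimensional ℚ U := Submodule.finiteDimensional_of_le inf_le_left
  have hWU_sup : W ⊔ U = V := by
    rw [hU, inf_comm, ← sup_inf_assoc_of_le U' (inf_le_left : W ≤ V), hU'.sup_eq_top, top_inf_eq]
  have hWU_disj : Disjoint W U := hU'.disjoint.mono_right inf_le_right
  have hUE_disj : Disjoint U Eq := by
    rw [disjoint_def]
    intro a haU haE
    exact (disjoint_def.mp hWU_disj) a ⟨inf_le_left (b := U') haU, haE⟩ haU
  set k := Module.finrank ℚ W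
  set m := Module.finrank ℚ U
  have hn : k + m = n := by
    have h1 := Submodule.finrank_sup_add_finrank_inf_eq W U
    rw [hWU_disj.eq_bot, finrank_bot, add_zero, hWU_sup] at h1
    rw [← h1, hV, finrank_span_eq_card hx, Fintype.card_fin]
  let bW := Module.finBasis ℚ W
  let bU := Module.finBasis ℚ U
  let y : Fin k → ℂ := fun i => (bW i : ℂ)
  let z : Fin m → ℂ := fun j => (bU j : ℂ)
  have hy_mem : ∀ i, y i ∈ ecl (∅ : Set ℂ) := fun i => ((bW i).2 : (bW i : ℂ) ∈ V ⊓ Eq).2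
  have hy_V : ∀ i, y i ∈ V := fun i => ((bW i).2 : (bW i : ℂ) ∈ V ⊓ Eq).1
  have hz_U : ∀ j, z j ∈ U := fun j => (bU j).2
  have hz_V : ∀ j, z j ∈ V := fun j => inf_le_left (b := U') (hz_U j)
  have hy_li : LinearIndependent ℚ y := bW.linearIndependent.map' W.subtype W.ker_subtype
  have hz_li : LinearIndependent ℚ z := bU.linearIndependent.map' U.subtype U.ker_subtype
  choose Ny hNy hNy_mem using fun i => exists_nsmul_mem_span_int x (hy_V i)
  choose Nz hNz hNz_mem using fun j => exists_nsmul_mem_span_int x (hz_V j)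
  let cy : Fin k → ℚˣ := fun i => Units.mk0 (Ny i : ℚ) (Nat.cast_ne_zero.mpr (hNy i))
  let cz : Fin m → ℚˣ := fun j => Units.mk0 (Nz j : ℚ) (Nat.cast_ne_zero.mpr (hNz j))
  let y' : Fin k → ℂ := fun i => (Ny i : ℚ) • y i
  let z' : Fin m → ℂ := fun j => (Nz j : ℚ) • z j
  have hy'_eq : cy • y = y' := by
    funext i; simp only [Pi.smul_apply', cy, y', Units.smul_def, Units.val_mk0]
  have hz'_eq : cz • z = z' := by
    funext j; simp only [Pi.smul_apply', cz, z', Units.smul_def, Units.val_mk0]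
  have hy'_li : LinearIndependent ℚ y' := hy'_eq ▸ hy_li.units_smul cy
  have hz'_li : LinearIndependent ℚ z' := hz'_eq ▸ hz_li.units_smul cz
  have hy'_mem : ∀ i, y' i ∈ ecl (∅ : Set ℂ) := fun i => Eq.smul_mem _ (hy_mem i)
  have hz'_U : ∀ j, z' j ∈ U := fun j => U.smul_mem _ (hz_U j)
  have hz'_modE : LinearIndependent ℚ ((span ℚ (ecl (∅ : Set ℂ))).mkQ ∘ z') := by
    refine hz'_li.map ?_
    rw [ker_mkQ, hspanE]
    exact hUE_disj.mono_left (span_le.mpr (Set.range_subset_iff.mpr hz'_U))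
  set Sy := Set.range y' ∪ Set.range (Complex.exp ∘ y') with hSy
  set Sz := Set.range z' ∪ Set.range (Complex.exp ∘ z') with hSz
  set Ky := adjoin ℚ Sy with hKy
  set L := adjoin ℚ (ecl (∅ : Set ℂ)) with hL
  have hkN : k ≤ N := by omega
  have hk : (k : Cardinal) ≤ Algebra.trdeg ℚ Ky := H k hkN y' hy'_mem hy'_li
  have hm₀ : (m : Cardinal) ≤ Algebra.trdeg L (adjoin L Sz) := hrel m z' hz'_modE
  have hKyL : Ky ≤ L := by
    rw [hKy, adjoin_le_iff]
    rintro a (⟨i, rfl⟩ | ⟨i, rfl⟩)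
    · exact subset_adjoin ℚ _ (hy'_mem i)
    · exact subset_adjoin ℚ _ (hexp _ (hy'_mem i))
  have hm : (m : Cardinal) ≤ Algebra.trdeg Ky (adjoin Ky Sz) :=
    hm₀.trans (trdeg_adjoin_le_of_le hKyL Sz)
  have hkm : (k : Cardinal) + m ≤ Algebra.trdeg ℚ (adjoin ℚ (Sy ∪ Sz)) :=
    add_le_trdeg_adjoin_union Sy Sz hk hm
  set Kx := adjoin ℚ (Set.range x ∪ Set.range (Complex.exp ∘ x)) with hKx
  have hle : adjoin ℚ (Sy ∪ Sz) ≤ Kx := by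
    rw [adjoin_le_iff]
    rintro a ((⟨i, rfl⟩ | ⟨i, rfl⟩) | (⟨j, rfl⟩ | ⟨j, rfl⟩))
    · exact (mem_adjoin_of_mem_span_int x (hNy_mem i)).1
    · exact (mem_adjoin_of_mem_span_int x (hNy_mem i)).2
    · exact (mem_adjoin_of_mem_span_int x (hNz_mem j)).1
    · exact (mem_adjoin_of_mem_span_int x (hNz_mem j)).2
  have hfin : Algebra.trdeg ℚ (adjoin ℚ (Sy ∪ Sz)) ≤ Algebra.trdeg ℚ Kx :=
    trdeg_le_of_injective (inclusion hle) (inclusion_injective hle)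
  calc (n : Cardinal) = (k : Cardinal) + m := by rw [← hn, Nat.cast_add]
    _ ≤ Algebra.trdeg ℚ (adjoin ℚ (Sy ∪ Sz)) := hkm
    _ ≤ Algebra.trdeg ℚ Kx := hfin

/-- **Stub `stub_eclReduction` of line `CardA_BW`** (Kirby 2010, Prop. 7.2 sliced at rank 2): the crux
`SchanuelTwo` follows from its restriction to pairs of exponentially algebraic numbers
(`x i ∈ ecl ∅`). Proof: `schanuelRank_of_ecl_le` at `N = 2` gives `SchanuelRank 2` — its restricted
hypothesis in rank `0` is trivial, in rank `1` is the Hermite–Lindemann floor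
`eclReduction_one_le_trdeg_of_linearIndependent`, and in rank `2` is the hypothesis of the stub — and
`SchanuelRank 2` is the crux up to the numeral cast `((2 : ℕ) : Cardinal) = 2`.
[cite: Kirby2010EAEF, Prop. 7.2] -/
theorem stub_eclReduction :
    (∀ x : Fin 2 → ℂ, (∀ i, x i ∈ Literature.NumberTheory.Transcendental.ecl (∅ : Set ℂ)) →
        LinearIndependent ℚ x →
        (2 : Cardinal) ≤ Algebra.trdeg ℚ
          ↥(IntermediateField.adjoin ℚ (Set.range x ∪ Set.range (Complex.exp ∘ x)))) →
      Summit.Schanuel.Schanuel.Theses.RoyCriterion.SchanuelTwo := by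
  intro H x hx
  have key : Literature.NumberTheory.Transcendental.SchanuelRank 2 := by
    refine schanuelRank_of_ecl_le 2 ?_ 2 le_rfl
    intro k hk y hy hli
    interval_cases k
    · simp
    · simpa using eclReduction_one_le_trdeg_of_linearIndependent y 0 hli
    · exact_mod_cast H y hy hli
  exact_mod_cast key x hx

end Summit.Schanuel.Schanuel.Theorems

end
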